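import Literature.MathematicalPhysics.QuantumFieldTheory.Balaban1983to89.B9Thm31SiteAgmonWeightY

/-!
# `Balaban1983to89.B9Thm31SiteGpGradDecayReg335Y` — T. Bałaban, *Propagators for lattice gauge theories in a background field*, Commun. Math. Phys. **99**
# (1985) 389–434 [Balaban1985BackgroundPropagators] Thm 3.1 (3.46) p. 398 (second inequality), by S. Agmon's positive-weight method [Agmon1982]:
# ★★★ **THE `L²`-LOCAL DECAY OF THE COVARIANT GRADIENT `∇_U G′(U)` ON THE (3.35) CLASS** — `Σ_{z∈A}Σ_μ HS((∇_{U,μ}G′(U)λ)(z)) ≤ 160·(L^{j_B})²·W⁻²·‖λ‖²₁`,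
# the SHAPE of print's `‖hζ∇_UG′(U)λ‖·(Lʲη) ≤ B₀(Lʲη)(Lʲ′η)e^{−δ₀d(y,y′)}‖h‖‖λ‖` (one local-scale factor fewer than for `G′` itself), member-∕volume-∕k-∕N-∕U-uniformly
# (file 8 of the site-coercivity set of width seat `pub-ymgap-dag-n06-w1`)

statement-level skeleton of published theorems with citation tags; proofs where landed; nothing here is a claim about the Yang–Mills mass gap

THE PRINT (p. 398, verbatim).  *«Finally, we have the inequalities in L₂-norms ‖hG′(U)λ‖, ‖hζ∇_UG′(U)λ‖(Lʲη), ‖hG′(U)∇\*_Uζλ‖(Lʲη), … ≤ B₀(Lʲη)(Lʲ′η)e^{−δ₀d(y,y′)}‖h‖‖λ‖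
for supp h ⊂ Δ̃(y), y ∈ Λ_j, supp λ ⊂ Δ̃(y′); (3.46)»* — so the gradient of `G′λ` read on `Δ̃(y)` is bounded by `B₀(Lʲ′η)e^{−δ₀d}‖λ‖`, WITHOUT the factor `Lʲη`.

WHY THIS FILE ∕ THE ARGUMENT.  Files 6–7 proved (3.46a) for def-Y's `G′(U) = GpY i (parSymY i) U` by Agmon's method; the same bookkeeping bounds the ENERGY of the
weighted field: with `Φ = G′Ψ`, `Φ′ = ωΦ`, `X = ⟨Φ, Ψ⟩₁`, `M = Σ_z m_zω_z²HS(Φ z)`, `κ = (d+1)θ_b + θ_s∕2 ≤ 1∕16`, `c₀ = 1∕8 − κ`: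
`Σ_μ‖∇_{U,μ}Φ′‖²₁ ≤ ⟨Φ′, Δ′_aΦ′⟩₁ ≤ ⟨ωΦ′, Δ′_a(ω⁻¹Φ′)⟩₁ + κM = X + κM` (file 5b's two-sided defect bound; the averaging part of (3.24) is `≥ 0`), and per bond
`ω_z∇Φ(z) = ∇(ωΦ)(z) − (ω(z+e_μ) − ω(z))·R(U_μ(z))Φ(z+e_μ)` with `(ω(z+e_μ) − ω(z))² ≤ 3θ_b·m·ω(z+e_μ)²` (bond ratios `q ≤ θ_b m ≤ 1`); hence
`W²·Σ_{z∈A}Σ_μHS(∇Φ(z)) ≤ 2(X + κM) + 6(d+1)θ_b·M ≤ 10X ≤ 160·(L^{j_B})²·‖Ψ‖²₁` by the two Agmon readings of file 6 (`c₀M ≤ X`, `c₀(L^{j_B})⁻²X ≤ ‖Ψ‖²`).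

WHAT IS PROVED (sorry-free; 0 `def`; nothing of [B9] asserted beyond what is proved).
* §1 `sum_trIP_cdS_le_trIP_deltaPrimeAY` (`Σ_μ‖∇_{U,μ}Φ‖²₁ ≤ ⟨Φ, Δ′_a(U)Φ⟩₁` on any inverse-symmetric `G`-valued table), `le_three_mul_of_q_le_one`, `sq_sub_le_of_q_le`
  (`(s − t)² ≤ 3θs²` when `q(s,t) ≤ θ ≤ 1`), `wsmul_cdS_eq` and ★ `hs_wsmul_cdS_le` (the per-bond algebra).
* §2 `grad_arith` (the real arithmetic) and ★★★ **`hs_restrict_cdS_GpY_parSymY_le`** (abstract weight: `Σ_{z∈A}Σ_μHS((∇_{U,μ}G′(U)Ψ)(z)) ≤ 160·((L^{j_B})²∕W²)·‖Ψ‖²₁` under file 6's hypotheses plus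
  `0 ≤ θ_b, θ_s`) and ★★★ **`hs_restrict_cdS_GpY_parSymY_le_exp_canonical`** (the weight `e^{δ₀ρ}`, `δ₀ = 1∕(4(d+2))`, block oscillation `≤ d+1`:
  `… ≤ 160·((L^{j_B})²∕(e^{δ₀r})²)·‖Ψ‖²₁`).
MODEL ∕ DECLARED READINGS.  As files 6–7; `∇_{U,μ} = cdS i U μ` (def-Y's covariant difference (3.3) on NODE 00's box chart, torus shift); the sum over `z ∈ A` of
`HS((∇_μΦ)(z))` counts the bonds leaving `A` in the `d+1` positive directions (print's `hζ∇_U`: a cutoff on bonds near `Δ̃(y)`).  NOT HERE: the adjoint companion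
`‖hG′(U)∇\*_Uζλ‖` (it follows from this one by the `trIP`-symmetry of `G′`, dag-n06-j's `isSymmTr_GpY_parSymY`, once the roles of `A` and `B` are exchanged — not
typed here), the second-order entries, (3.42)–(3.45), (3.47), the bond sector.
HONEST SCOPE.  A decay estimate for one finite lattice operator at a time, constants explicit; NOT a node discharge, NOT summit progress; count-neutral;
nothing continuum ∕ OS ∕ mass gap ∕ Clay.  NEW file importing file 7 only; nothing landed is modified.  Net new unproved facts: 0.
-/

noncomputable section

namespace Literature.MathematicalPhysics.QuantumFieldTheory.Balaban1983to89.B9Thm31SiteGpGradDecayReg335Y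

open Literature.MathematicalPhysics.QuantumFieldTheory.Balaban1983to89
open Node00 B6KLevelCensusIndexV1 B6Geom246MultiLevelBox B6MultiLevelBoxOperator B6MultiLevelTorusOperator B6GlobalChartV1 B9BackgroundsKLevelV1
  B9Eq39Adjoint B9Thm311ReadingCoords B9Thm311DeltaPrimePos B9Ineq369CurvatureSmallAtLettersY B9Thm31SiteCoerciveGaugeBlockY
  B9Thm31SiteCoerciveReg335Y B9Thm31SiteGpBoundsReg335Y B9Thm31SitePolarisedFormY B9Thm31SiteConjugatedFormY B9Thm31SiteGpDecayReg335Y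
  B9Thm31SiteAgmonWeightY
open Literature.MathematicalPhysics.QuantumFieldTheory.Balaban1983to89.B9Thm311FlippedBondLetters (hs_real_smul)
open scoped Matrix Matrix.Norms.L2Operator

variable {d ℓ : ℕ} {hd : 1 ≤ d + 1} {hL : Odd (ℓ + 1) ∧ 1 < ℓ + 1} {b₀ b₁ : ℝ}
variable (i : KIdx d ℓ hd hL b₀ b₁) {N : ℕ} {G : Subgroup (Matrix (Fin N) (Fin N) ℂ)ˣ}

/-! ## §1 The energy is dominated by the form; the per-bond algebra of the weighted gradient -/

/-- THE GRADIENT ENERGY IS DOMINATED BY (3.24)'s FORM (the averaging part is `≥ 0`): `Σ_μ‖∇_{U,μ}Φ‖²₁ ≤ ⟨Φ, Δ′_a(U)Φ⟩₁` on any inverse-symmetric `G`-valued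
table at a `G`-valued background, `G ≤ U(N)`. [cite: Balaban1985BackgroundPropagators, (3.23)–(3.24) pp.394–395] -/
theorem sum_trIP_cdS_le_trIP_deltaPrimeAY (hG : G ≤ B7Prop2Explicit.unitaryUnits (Matrix (Fin N) (Fin N) ℂ))
    (par : SiteParY (Matrix (Fin N) (Fin N) ℂ) i) (U : CfgY (Matrix (Fin N) (Fin N) ℂ) i) (hinv : ∀ z z' : SiteY i, par U z z' = (par U z' z)⁻¹)
    (hpar : ∀ z w : SiteY i, par U z w ∈ G) (hU : ∀ μ x, U μ x ∈ G) (Φ : SiteY i → Matrix (Fin N) (Fin N) ℂ) :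
    ∑ μ : Fin (d + 1), trIP (fun _ => (1 : ℝ)) (cdS i U μ Φ) (cdS i U μ Φ) ≤ trIP (fun _ => (1 : ℝ)) Φ (deltaPrimeAY i par U Φ) := by
  rw [trIP_deltaPrimeAY_eq i hG par U hinv hpar hU Φ]
  have h0 : 0 ≤ ∑ s : BlkY i, levC d ℓ (aPrinted ℓ 1) s.1.1 * (Matrix.trace ((blkSumY i par U Φ s)ᴴ * blkSumY i par U Φ s)).re :=
    Finset.sum_nonneg fun s _ => mul_nonneg (levC_blk_pos i s).le (re_trace_conjTranspose_mul_self_nonneg _)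
  linarith

/-- if `q(s,t) = s∕t + t∕s − 2 ≤ 1` for `s, t > 0` then `t ≤ 3s`. [cite: Agmon1982, Ch.1, bookkeeping] -/
theorem le_three_mul_of_q_le_one {s t : ℝ} (hs : 0 < s) (ht : 0 < t) (hq : s / t + t / s - 2 ≤ 1) : t ≤ 3 * s := by
  have h1 : 0 < s / t := div_pos hs ht
  have h2 : t / s ≤ 3 := by linarith
  rwa [div_le_iff₀ hs] at h2

/-- `(s − t)² = st·q(s,t) ≤ 3θ·s²` when `0 ≤ q(s,t) ≤ θ ≤ 1`, `s, t > 0`. [cite: Agmon1982, Ch.1, bookkeeping] -/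
theorem sq_sub_le_of_q_le {s t θ : ℝ} (hs : 0 < s) (ht : 0 < t) (hq : s / t + t / s - 2 ≤ θ) (hθ : θ ≤ 1) : (s - t) ^ 2 ≤ 3 * θ * s ^ 2 := by
  have hq0 : 0 ≤ s / t + t / s - 2 := q_nonneg hs ht
  have ht3 : t ≤ 3 * s := le_three_mul_of_q_le_one hs ht (hq.trans hθ)
  have e : (s - t) ^ 2 = s * t * (s / t + t / s - 2) := by field_simp; ring
  rw [e]
  calc s * t * (s / t + t / s - 2) ≤ s * (3 * s) * (s / t + t / s - 2) :=
        mul_le_mul_of_nonneg_right (mul_le_mul_of_nonneg_left ht3 hs.le) hq0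
    _ ≤ s * (3 * s) * θ := mul_le_mul_of_nonneg_left hq (by positivity)
    _ = 3 * θ * s ^ 2 := by ring

/-- THE PER-BOND ALGEBRA: `ω(z)·(∇_{U,μ}Φ)(z) = (∇_{U,μ}(ωΦ))(z) − (ω(z+e_μ) − ω(z))·R(U_μ(z))Φ(z+e_μ)`. [cite: Agmon1982, Ch.1; Balaban1985BackgroundPropagators, (3.3) p.390] -/
theorem wsmul_cdS_eq (U : CfgY (Matrix (Fin N) (Fin N) ℂ) i) (μ : Fin (d + 1)) (ω : SiteY i → ℝ) (Φ : SiteY i → Matrix (Fin N) (Fin N) ℂ) (z : SiteY i) :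
    ((ω z : ℝ) : ℂ) • cdS i U μ Φ z
      = cdS i U μ (fun w => ((ω w : ℝ) : ℂ) • Φ w) z - (((ω (shiftY i μ z) - ω z : ℝ)) : ℂ) • R (UboxY i U μ z) (Φ (shiftY i μ z)) := by
  rw [cdS_wsmul_apply, cdS_apply_eq i U μ Φ z, Complex.ofReal_one, one_smul, one_smul, Complex.ofReal_sub, sub_smul, smul_sub]
  abel

/-- ★ THE PER-BOND BOUND at a `G`-valued background, `G ≤ U(N)`: `ω(z)²·HS((∇_{U,μ}Φ)(z)) ≤ 2·HS((∇_{U,μ}(ωΦ))(z)) + 2(ω(z+e_μ) − ω(z))²·HS(Φ(z+e_μ))`.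
[cite: Agmon1982, Ch.1; Balaban1985BackgroundPropagators, (3.3) p.390, Thm 3.1 (3.46) p.398] -/
theorem hs_wsmul_cdS_le (hG : G ≤ B7Prop2Explicit.unitaryUnits (Matrix (Fin N) (Fin N) ℂ)) {U : CfgY (Matrix (Fin N) (Fin N) ℂ) i}
    (hU : ∀ μ x, U μ x ∈ G) (μ : Fin (d + 1)) (ω : SiteY i → ℝ) (Φ : SiteY i → Matrix (Fin N) (Fin N) ℂ) (z : SiteY i) :
    ω z ^ 2 * ∑ a, ∑ b, ‖cdS i U μ Φ z a b‖ ^ 2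
      ≤ 2 * ∑ a, ∑ b, ‖cdS i U μ (fun w => ((ω w : ℝ) : ℂ) • Φ w) z a b‖ ^ 2 + 2 * ((ω (shiftY i μ z) - ω z) ^ 2 * ∑ a, ∑ b, ‖Φ (shiftY i μ z) a b‖ ^ 2) := by
  rw [← hs_real_smul (ω z) (cdS i U μ Φ z), wsmul_cdS_eq i U μ ω Φ z]
  have h1 := hs_sub_le (cdS i U μ (fun w => ((ω w : ℝ) : ℂ) • Φ w) z) ((((ω (shiftY i μ z) - ω z : ℝ)) : ℂ) • R (UboxY i U μ z) (Φ (shiftY i μ z)))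
  have h2 : ∑ a, ∑ b, ‖((((ω (shiftY i μ z) - ω z : ℝ)) : ℂ) • R (UboxY i U μ z) (Φ (shiftY i μ z))) a b‖ ^ 2
      ≤ (ω (shiftY i μ z) - ω z) ^ 2 * ∑ a, ∑ b, ‖Φ (shiftY i μ z) a b‖ ^ 2 := by
    rw [hs_real_smul]
    exact mul_le_mul_of_nonneg_left (hs_R_le (contractive_of_mem_unitary (V := UboxY i U μ z) (hG (hU μ _))) _) (sq_nonneg _)
  linarith

/-! ## §2 (3.46b): the decay of the gradient of `G′(U)` -/

/-- THE ARITHMETIC OF §2: `E ≤ X + κM`, `S ≤ 2E + 6θM`, `W²P ≤ S`, `κ, θ ≤ 1∕16`, `(1∕8 − κ)M ≤ X`, `(1∕8 − κ)L_B⁻¹X ≤ Q`, `M ≥ 0`, `W, L_B > 0` ⇒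
`P ≤ 160·(L_B∕W²)·Q`. [cite: Agmon1982, Ch.1, bookkeeping] -/
theorem grad_arith {E X M S P Q W LB κ θ : ℝ} (hE : E ≤ X + κ * M) (hS : S ≤ 2 * E + 6 * θ * M) (hP : W ^ 2 * P ≤ S) (hκ : κ ≤ 1 / 16)
    (hθ : θ ≤ 1 / 16) (hiX : (1 / 8 - κ) * M ≤ X) (hXQ : (1 / 8 - κ) * LB⁻¹ * X ≤ Q) (hM0 : 0 ≤ M) (hW : 0 < W) (hLB : 0 < LB) :
    P ≤ 160 * (LB / W ^ 2) * Q := by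
  have hc : (1 / 16 : ℝ) ≤ 1 / 8 - κ := by linarith
  have hX0 : 0 ≤ X := le_trans (mul_nonneg (le_trans (by norm_num) hc) hM0) hiX
  have hMX : M ≤ 16 * X := by nlinarith
  have hS' : S ≤ 10 * X := by nlinarith
  have h1 : (1 / 8 - κ) * X ≤ LB * Q := by
    have h := mul_le_mul_of_nonneg_left hXQ hLB.le
    rwa [show LB * ((1 / 8 - κ) * LB⁻¹ * X) = (1 / 8 - κ) * X by field_simp] at h
  have hXQ' : X ≤ 16 * (LB * Q) := by nlinarith
  have h2 : W ^ 2 * P ≤ 160 * (LB * Q) := by linarith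
  have hW2 : 0 < W ^ 2 := by positivity
  calc P = (W ^ 2)⁻¹ * (W ^ 2 * P) := by rw [← mul_assoc, inv_mul_cancel₀ hW2.ne', one_mul]
    _ ≤ (W ^ 2)⁻¹ * (160 * (LB * Q)) := mul_le_mul_of_nonneg_left h2 (inv_nonneg.2 hW2.le)
    _ = 160 * (LB / W ^ 2) * Q := by rw [div_eq_mul_inv]; ring


/-- ★★★ **THE `L²`-LOCAL DECAY OF `∇_U G′(U)` ON THE CLASS (3.35) — (3.46b)'s SHAPE BY AGMON'S METHOD.**  Hypotheses as file 6's `hs_restrict_GpY_parSymY_le`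
(class, weight `ω` with `ω = 1` on `B ⊇ supp Ψ`, `ω ≥ W > 0` on `A`, bond ratios `q ≤ θ_b·(L^{lev})⁻²` at both ends, block oscillation `q ≤ θ_s`,
`(d+1)θ_b + θ_s∕2 ≤ 1∕16`, levels `≤ j_B` on `B`) plus `0 ≤ θ_b`, `0 ≤ θ_s`.  THEN `Σ_{z∈A}Σ_μ HS((∇_{U,μ}G′(U)Ψ)(z)) ≤ 160·((L^{j_B})²∕W²)·‖Ψ‖²₁` — NO factor
`(L^{j_A})²`, as in print. [cite: Balaban1985BackgroundPropagators, Thm 3.1 (3.46) p.398, (3.35) p.396; Agmon1982, Ch.1, Thm 1.5] -/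
theorem hs_restrict_cdS_GpY_parSymY_le [Nonempty (Fin N)] (hG : G ≤ B7Prop2Explicit.unitaryUnits (Matrix (Fin N) (Fin N) ℂ))
    {U : CfgY (Matrix (Fin N) (Fin N) ℂ) i} {c α₀ : ℝ} (hC0 : 0 ≤ c * (kGeo i).M * α₀) (hC1 : c * (kGeo i).M * α₀ * ((d : ℝ) + 1) ≤ 1 / 16)
    (hreg : (bg9K (Matrix (Fin N) (Fin N) ℂ) G i).Reg335 c α₀ U) {ω : SiteY i → ℝ} (hω : ∀ z, 0 < ω z) {θb θs : ℝ} (hθb0 : 0 ≤ θb) (hθs0 : 0 ≤ θs)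
    (hb1 : ∀ μ z, ω (shiftY i μ z) / ω z + ω z / ω (shiftY i μ z) - 2 ≤ θb * (((((ℓ + 1) ^ (blkOf i.D.toDomains z).1.1 : ℕ) : ℝ)) ^ 2)⁻¹)
    (hb2 : ∀ μ z, ω (shiftY i μ z) / ω z + ω z / ω (shiftY i μ z) - 2 ≤ θb * (((((ℓ + 1) ^ (blkOf i.D.toDomains (shiftY i μ z)).1.1 : ℕ) : ℝ)) ^ 2)⁻¹)
    (hs : ∀ z w : SiteY i, blkOf i.D.toDomains w = blkOf i.D.toDomains z → ω z / ω w + ω w / ω z - 2 ≤ θs)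
    (hκ : ((d : ℝ) + 1) * θb + θs / 2 ≤ 1 / 16)
    {A B : Finset (SiteY i)} {Ψ : SiteY i → Matrix (Fin N) (Fin N) ℂ} (hΨ : ∀ z, z ∉ B → Ψ z = 0) (hωB : ∀ z ∈ B, ω z = 1)
    {jB : ℕ} (hjB : ∀ z ∈ B, (blkOf i.D.toDomains z).1.1 ≤ jB) {W : ℝ} (hW0 : 0 < W) (hW : ∀ z ∈ A, W ≤ ω z) :
    ∑ z ∈ A, ∑ μ : Fin (d + 1), ∑ a, ∑ b, ‖cdS i U μ (GpY i (parSymY i) U Ψ) z a b‖ ^ 2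
      ≤ 160 * (((((ℓ + 1) ^ jB : ℕ) : ℝ)) ^ 2 / W ^ 2) * trIP (fun _ => (1 : ℝ)) Ψ Ψ := by
  have hU : ∀ μ x, U μ x ∈ G := hreg.1
  have hθ : ((d : ℝ) + 1) * θb ≤ 1 / 16 := by linarith
  have hm1 : ∀ z : SiteY i, (((((ℓ + 1) ^ (blkOf i.D.toDomains z).1.1 : ℕ) : ℝ)) ^ 2)⁻¹ ≤ 1 := fun z => by
    have h1 : (1 : ℝ) ≤ (((ℓ + 1) ^ (blkOf i.D.toDomains z).1.1 : ℕ) : ℝ) := by exact_mod_cast Nat.one_le_pow _ _ (Nat.succ_pos ℓ)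
    exact inv_le_one_of_one_le₀ (by nlinarith)
  have hM0 : 0 ≤ ∑ z : SiteY i, (((((ℓ + 1) ^ (blkOf i.D.toDomains z).1.1 : ℕ) : ℝ)) ^ 2)⁻¹ * ∑ a, ∑ b, ‖(((ω z : ℝ) : ℂ) • GpY i (parSymY i) U Ψ z) a b‖ ^ 2 :=
    Finset.sum_nonneg fun z _ => mul_nonneg (inv_nonneg.2 (by positivity)) (hs_nonneg _)
  -- Agmon's two readings (file 6)
  have hiX := levelMass_wsmul_GpY_le_pairing i hG hC0 hC1 hreg hω hb1 hb2 hs hΨ hωB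
  have hXQ := pairing_GpY_le_of_support i hG hC0 hC1 hreg hω hb1 hb2 hs hκ hΨ hωB hjB
  -- the energy of the weighted field: `E ≤ ⟨Φ′, Δ′Φ′⟩ ≤ conj + κM = X + κM`
  have hE : ∑ μ : Fin (d + 1), trIP (fun _ => (1 : ℝ)) (cdS i U μ (fun w => ((ω w : ℝ) : ℂ) • GpY i (parSymY i) U Ψ w))
        (cdS i U μ (fun w => ((ω w : ℝ) : ℂ) • GpY i (parSymY i) U Ψ w))
      ≤ trIP (fun _ => (1 : ℝ)) (GpY i (parSymY i) U Ψ) Ψ + (((d : ℝ) + 1) * θb + θs / 2) *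
          ∑ z : SiteY i, (((((ℓ + 1) ^ (blkOf i.D.toDomains z).1.1 : ℕ) : ℝ)) ^ 2)⁻¹ * ∑ a, ∑ b, ‖(((ω z : ℝ) : ℂ) • GpY i (parSymY i) U Ψ z) a b‖ ^ 2 := by
    have h1 := sum_trIP_cdS_le_trIP_deltaPrimeAY i hG (parSymY i) U (parSymY_inv_symm U) (fun z w => parSymY_mem i hU z w) hU
      (fun w => ((ω w : ℝ) : ℂ) • GpY i (parSymY i) U Ψ w)
    have h2 := trIP_wsmul_deltaPrimeAY_winv_ge i hG (parSymY i) U (parSymY_inv_symm U) (fun z w => parSymY_mem i hU z w) hU hω hb1 hb2 hs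
      (fun w => ((ω w : ℝ) : ℂ) • GpY i (parSymY i) U Ψ w)
    rw [conj_wsmul_GpY_eq_pairing i hG hU hω hΨ hωB] at h2
    linarith
  -- the per-bond algebra, summed: `Σ_zΣ_μ ω_z²HS(∇Φ z) ≤ 2E + 6(d+1)θ_b M`
  have hdef : ∀ μ z, (ω (shiftY i μ z) - ω z) ^ 2 * ∑ a, ∑ b, ‖GpY i (parSymY i) U Ψ (shiftY i μ z) a b‖ ^ 2
      ≤ 3 * θb * ((((((ℓ + 1) ^ (blkOf i.D.toDomains (shiftY i μ z)).1.1 : ℕ) : ℝ)) ^ 2)⁻¹ *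
          ∑ a, ∑ b, ‖(((ω (shiftY i μ z) : ℝ) : ℂ) • GpY i (parSymY i) U Ψ (shiftY i μ z)) a b‖ ^ 2) := by
    intro μ z
    have hθm : θb * (((((ℓ + 1) ^ (blkOf i.D.toDomains (shiftY i μ z)).1.1 : ℕ) : ℝ)) ^ 2)⁻¹ ≤ 1 := by
      have hd1 : θb ≤ 1 / 16 := by
        have : (0 : ℝ) ≤ d := Nat.cast_nonneg d
        nlinarith
      have h0 : (0 : ℝ) ≤ (((((ℓ + 1) ^ (blkOf i.D.toDomains (shiftY i μ z)).1.1 : ℕ) : ℝ)) ^ 2)⁻¹ := inv_nonneg.2 (by positivity)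
      nlinarith [hm1 (shiftY i μ z)]
    have h := sq_sub_le_of_q_le (hω (shiftY i μ z)) (hω z) (hb2 μ z) hθm
    rw [hs_real_smul]
    have hX' := hs_nonneg (GpY i (parSymY i) U Ψ (shiftY i μ z))
    calc (ω (shiftY i μ z) - ω z) ^ 2 * ∑ a, ∑ b, ‖GpY i (parSymY i) U Ψ (shiftY i μ z) a b‖ ^ 2
        ≤ (3 * (θb * (((((ℓ + 1) ^ (blkOf i.D.toDomains (shiftY i μ z)).1.1 : ℕ) : ℝ)) ^ 2)⁻¹) * ω (shiftY i μ z) ^ 2) *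
            ∑ a, ∑ b, ‖GpY i (parSymY i) U Ψ (shiftY i μ z) a b‖ ^ 2 := mul_le_mul_of_nonneg_right h hX'
      _ = _ := by ring
  have hsum : ∑ z : SiteY i, ∑ μ : Fin (d + 1), ω z ^ 2 * ∑ a, ∑ b, ‖cdS i U μ (GpY i (parSymY i) U Ψ) z a b‖ ^ 2
      ≤ 2 * ∑ μ : Fin (d + 1), trIP (fun _ => (1 : ℝ)) (cdS i U μ (fun w => ((ω w : ℝ) : ℂ) • GpY i (parSymY i) U Ψ w))
            (cdS i U μ (fun w => ((ω w : ℝ) : ℂ) • GpY i (parSymY i) U Ψ w))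
        + 6 * (((d : ℝ) + 1) * θb) *
          ∑ z : SiteY i, (((((ℓ + 1) ^ (blkOf i.D.toDomains z).1.1 : ℕ) : ℝ)) ^ 2)⁻¹ * ∑ a, ∑ b, ‖(((ω z : ℝ) : ℂ) • GpY i (parSymY i) U Ψ z) a b‖ ^ 2 := by
    rw [Finset.sum_comm]
    have hμ : ∀ μ : Fin (d + 1), ∑ z : SiteY i, ω z ^ 2 * ∑ a, ∑ b, ‖cdS i U μ (GpY i (parSymY i) U Ψ) z a b‖ ^ 2
        ≤ 2 * trIP (fun _ => (1 : ℝ)) (cdS i U μ (fun w => ((ω w : ℝ) : ℂ) • GpY i (parSymY i) U Ψ w))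
            (cdS i U μ (fun w => ((ω w : ℝ) : ℂ) • GpY i (parSymY i) U Ψ w))
          + 6 * θb * ∑ z : SiteY i, (((((ℓ + 1) ^ (blkOf i.D.toDomains z).1.1 : ℕ) : ℝ)) ^ 2)⁻¹ *
              ∑ a, ∑ b, ‖(((ω z : ℝ) : ℂ) • GpY i (parSymY i) U Ψ z) a b‖ ^ 2 := by
      intro μ
      have hz : ∀ z, ω z ^ 2 * ∑ a, ∑ b, ‖cdS i U μ (GpY i (parSymY i) U Ψ) z a b‖ ^ 2
          ≤ 2 * ∑ a, ∑ b, ‖cdS i U μ (fun w => ((ω w : ℝ) : ℂ) • GpY i (parSymY i) U Ψ w) z a b‖ ^ 2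
            + 2 * (3 * θb * ((((((ℓ + 1) ^ (blkOf i.D.toDomains (shiftY i μ z)).1.1 : ℕ) : ℝ)) ^ 2)⁻¹ *
                ∑ a, ∑ b, ‖(((ω (shiftY i μ z) : ℝ) : ℂ) • GpY i (parSymY i) U Ψ (shiftY i μ z)) a b‖ ^ 2)) := by
        intro z
        have h1 := hs_wsmul_cdS_le i hG hU μ ω (GpY i (parSymY i) U Ψ) z
        have h2 := hdef μ z
        linarith
      refine (Finset.sum_le_sum fun z _ => hz z).trans (le_of_eq ?_)
      rw [Finset.sum_add_distrib, ← Finset.mul_sum, ← Finset.mul_sum, trIP_one_self_eq,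
        Equiv.sum_comp (shiftY i μ) (fun z => 3 * θb * ((((((ℓ + 1) ^ (blkOf i.D.toDomains z).1.1 : ℕ) : ℝ)) ^ 2)⁻¹ *
          ∑ a, ∑ b, ‖(((ω z : ℝ) : ℂ) • GpY i (parSymY i) U Ψ z) a b‖ ^ 2)), ← Finset.mul_sum]
      ring
    calc ∑ μ : Fin (d + 1), ∑ z : SiteY i, ω z ^ 2 * ∑ a, ∑ b, ‖cdS i U μ (GpY i (parSymY i) U Ψ) z a b‖ ^ 2
        ≤ ∑ μ : Fin (d + 1), (2 * trIP (fun _ => (1 : ℝ)) (cdS i U μ (fun w => ((ω w : ℝ) : ℂ) • GpY i (parSymY i) U Ψ w))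
              (cdS i U μ (fun w => ((ω w : ℝ) : ℂ) • GpY i (parSymY i) U Ψ w))
            + 6 * θb * ∑ z : SiteY i, (((((ℓ + 1) ^ (blkOf i.D.toDomains z).1.1 : ℕ) : ℝ)) ^ 2)⁻¹ *
                ∑ a, ∑ b, ‖(((ω z : ℝ) : ℂ) • GpY i (parSymY i) U Ψ z) a b‖ ^ 2) := Finset.sum_le_sum fun μ _ => hμ μ
      _ = _ := by
          rw [Finset.sum_add_distrib, ← Finset.mul_sum, Finset.sum_const, Finset.card_univ, Fintype.card_fin, nsmul_eq_mul]; push_cast; ring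
  -- restrict to `A`, where `ω ≥ W`
  have hPA : W ^ 2 * ∑ z ∈ A, ∑ μ : Fin (d + 1), ∑ a, ∑ b, ‖cdS i U μ (GpY i (parSymY i) U Ψ) z a b‖ ^ 2
      ≤ ∑ z : SiteY i, ∑ μ : Fin (d + 1), ω z ^ 2 * ∑ a, ∑ b, ‖cdS i U μ (GpY i (parSymY i) U Ψ) z a b‖ ^ 2 := by
    rw [Finset.mul_sum]
    have hterm : ∀ z, 0 ≤ ∑ μ : Fin (d + 1), ω z ^ 2 * ∑ a, ∑ b, ‖cdS i U μ (GpY i (parSymY i) U Ψ) z a b‖ ^ 2 :=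
      fun z => Finset.sum_nonneg fun μ _ => mul_nonneg (sq_nonneg _) (hs_nonneg _)
    refine le_trans (Finset.sum_le_sum fun z hz => ?_) (Finset.sum_le_univ_sum_of_nonneg hterm)
    rw [Finset.mul_sum]
    exact Finset.sum_le_sum fun μ _ => mul_le_mul_of_nonneg_right (pow_le_pow_left₀ hW0.le (hW z hz) 2) (hs_nonneg _)
  exact grad_arith hE hsum hPA hκ hθ hiX hXQ hM0 hW0 (by positivity)

/-- ★★★ **(3.46b) WITH THE CANONICAL AGMON WEIGHT**: `ρ` with `|ρ(z+e_μ) − ρ z| ≤ (L^{lev})⁻¹` at both ends of every bond, `|ρ z − ρ w| ≤ d+1` on every block of `𝔅`,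
`ρ = 0` on `B ⊇ supp Ψ`, `ρ ≥ r` on `A`, levels `≤ j_B` on `B`, `δ₀ = 1∕(4(d+2))`: `Σ_{z∈A}Σ_μ HS((∇_{U,μ}G′(U)Ψ)(z)) ≤ 160·((L^{j_B})²∕(e^{δ₀r})²)·‖Ψ‖²₁` on the
class. [cite: Balaban1985BackgroundPropagators, Thm 3.1 (3.46) p.398; Agmon1982, Ch.1, Thm 1.5] -/
theorem hs_restrict_cdS_GpY_parSymY_le_exp_canonical [Nonempty (Fin N)] (hG : G ≤ B7Prop2Explicit.unitaryUnits (Matrix (Fin N) (Fin N) ℂ))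
    {U : CfgY (Matrix (Fin N) (Fin N) ℂ) i} {c α₀ : ℝ} (hC0 : 0 ≤ c * (kGeo i).M * α₀) (hC1 : c * (kGeo i).M * α₀ * ((d : ℝ) + 1) ≤ 1 / 16)
    (hreg : (bg9K (Matrix (Fin N) (Fin N) ℂ) G i).Reg335 c α₀ U) {ρ : SiteY i → ℝ}
    (hρ1 : ∀ μ z, |ρ (shiftY i μ z) - ρ z| ≤ ((((ℓ + 1) ^ (blkOf i.D.toDomains z).1.1 : ℕ) : ℝ))⁻¹)
    (hρ2 : ∀ μ z, |ρ (shiftY i μ z) - ρ z| ≤ ((((ℓ + 1) ^ (blkOf i.D.toDomains (shiftY i μ z)).1.1 : ℕ) : ℝ))⁻¹)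
    (hρD : ∀ z w : SiteY i, blkOf i.D.toDomains w = blkOf i.D.toDomains z → |ρ z - ρ w| ≤ (d : ℝ) + 1)
    {A B : Finset (SiteY i)} {Ψ : SiteY i → Matrix (Fin N) (Fin N) ℂ} (hΨ : ∀ z, z ∉ B → Ψ z = 0) (hρB : ∀ z ∈ B, ρ z = 0)
    {jB : ℕ} (hjB : ∀ z ∈ B, (blkOf i.D.toDomains z).1.1 ≤ jB) {r : ℝ} (hr : ∀ z ∈ A, r ≤ ρ z) :
    ∑ z ∈ A, ∑ μ : Fin (d + 1), ∑ a, ∑ b, ‖cdS i U μ (GpY i (parSymY i) U Ψ) z a b‖ ^ 2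
      ≤ 160 * (((((ℓ + 1) ^ jB : ℕ) : ℝ)) ^ 2 / Real.exp ((1 / (4 * ((d : ℝ) + 2))) * r) ^ 2) * trIP (fun _ => (1 : ℝ)) Ψ Ψ := by
  have hd0 : (0 : ℝ) ≤ d := Nat.cast_nonneg d
  have hd2 : (0 : ℝ) < 4 * ((d : ℝ) + 2) := by positivity
  have hδ0 : (0 : ℝ) ≤ 1 / (4 * ((d : ℝ) + 2)) := by positivity
  have hδ1 : 1 / (4 * ((d : ℝ) + 2)) ≤ 1 := by rw [div_le_one hd2]; linarith
  have hδD : 1 / (4 * ((d : ℝ) + 2)) * ((d : ℝ) + 1) ≤ 1 := by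
    rw [div_mul_eq_mul_div, one_mul, div_le_one hd2]; linarith
  have hδκ0 : (1 / (4 * ((d : ℝ) + 2))) ^ 2 * (2 * ((d : ℝ) + 1) + ((d : ℝ) + 1) ^ 2) ≤ 1 / 16 := by
    rw [div_pow, one_pow, mul_pow, one_div_mul_eq_div, div_le_iff₀ (by positivity)]
    nlinarith
  have hδκ : ((d : ℝ) + 1) * (2 * (1 / (4 * ((d : ℝ) + 2))) ^ 2) + (2 * (1 / (4 * ((d : ℝ) + 2))) ^ 2 * ((d : ℝ) + 1) ^ 2) / 2 ≤ 1 / 16 := by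
    have e : ((d : ℝ) + 1) * (2 * (1 / (4 * ((d : ℝ) + 2))) ^ 2) + (2 * (1 / (4 * ((d : ℝ) + 2))) ^ 2 * ((d : ℝ) + 1) ^ 2) / 2
        = (1 / (4 * ((d : ℝ) + 2))) ^ 2 * (2 * ((d : ℝ) + 1) + ((d : ℝ) + 1) ^ 2) := by ring
    rw [e]; exact hδκ0
  have hω : ∀ z, 0 < Real.exp (1 / (4 * ((d : ℝ) + 2)) * ρ z) := fun z => Real.exp_pos _
  have hωB : ∀ z ∈ B, Real.exp (1 / (4 * ((d : ℝ) + 2)) * ρ z) = 1 := fun z hz => by rw [hρB z hz, mul_zero, Real.exp_zero]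
  have hW : ∀ z ∈ A, Real.exp (1 / (4 * ((d : ℝ) + 2)) * r) ≤ Real.exp (1 / (4 * ((d : ℝ) + 2)) * ρ z) :=
    fun z hz => Real.exp_le_exp.2 (mul_le_mul_of_nonneg_left (hr z hz) hδ0)
  exact hs_restrict_cdS_GpY_parSymY_le i hG hC0 hC1 hreg hω (by positivity) (by positivity)
    (fun μ z => bondRatio_exp_le i hδ0 hδ1 μ z (hρ1 μ z)) (fun μ z => bondRatio_exp_le' i hδ0 hδ1 μ z (hρ2 μ z))
    (fun z w hzw => blockOsc_exp_le i hδ0 hδD z w (hρD z w hzw)) hδκ hΨ hωB hjB (Real.exp_pos _) hW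

end Literature.MathematicalPhysics.QuantumFieldTheory.Balaban1983to89.B9Thm31SiteGpGradDecayReg335Y
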